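import Summits.RiemannHypothesis.RiemannHypothesis.Theorems.Splittings.LiCurvatureSignChangesRH
import HarnessLib

/-!
# The curvature of Li's coefficients CHANGES SIGN ON A SYNDETIC SET, UNCONDITIONALLY — ¬RH branch and the hypothesis-free corollaries (SketchG7 §§3–4)

Cell rh-split, seat rh-split-li-bridge g7 (brief sha16 f79c5f09d8bcb036), card `run/shared/lean/pub/rh-split/cards/SPLIT-li-bridge.md` §14
(referee rh-split-ref g5: REPLAY PASS of v1 353a9a80816aea0e + v2 ca059ef508c1d3b5, 08:37:53Z; labels L1–L4 there); kernel source
`HOME/rh-split-li-bridge/SketchG7.lean` sha16 dac2b83ce457a730 (1546 l; = v2 + §5e `not_tendsto_liSecondDiff/_liFdiff` + 28 one-line docstrings,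
no decl text changed).  Cut by the seat (lead RULING #60, lane (xi-g)) into SIX tree modules at the scratch's section boundaries, decl text
byte-verbatim; deltas = namespace `RhSplit.LiBridgeG7` ↦ `…Theorems.Splittings.{LiWindowComplex, LiCurvatureSignChanges, LiDifferenceOrderLaw}`
(+ `open` of the earlier namespaces of the chain), module docstrings, and the variable-free wrapper `section HigherOrder … end HigherOrder`
dropped.  END-TO-END statement of the chain (last file): `LiDifferenceOrderLaw.liFdiff_signs_syndetic (hK : 2 ≤ K) :
∃ η > 0, ∃ L, ∀ N, (∃ n ∈ Ico N (N+L), fdiff K keiperLiCoeff n ≤ −η) ∧ (∃ n ∈ Ico N (N+L), η ≤ fdiff K keiperLiCoeff n)` — every forward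
difference of order `K ≥ 2` of Li's coefficients (K = 2: the curvature `d_n = λ_{n+2} − 2λ_{n+1} + λ_n`, file `LiCurvatureSignChanges`) takes
BOTH signs with a margin on a syndetic set, UNCONDITIONALLY (proof by cases on `RiemannHypothesis`; an RH-free kernel theorem about `λ_n`
alone, referee label L1; certifies nothing about RH; class (li, bridge) unchanged).

This file: §3 ¬RH branch: discrete Rolle (`no_convex_dip`, `no_concave_bump`), quadratic tilt, the tree's `LiExtremalLayer.li_two_signs_of_not_rh` ⟹
`liSecondDiff_two_signs_of_not_rh (hRH : ¬RH) (hη : 0 ≤ η)` (every margin, late windows of bounded length; label L3).  §4 (`Classical.em RH`):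
`liSecondDiff_signs_syndetic : ∃ η > 0, ∃ L, ∀ N, (∃ n ∈ Ico N (N+L), d_n ≤ −η) ∧ (∃ n ∈ Ico N (N+L), η ≤ d_n)`, `not_eventually_convex/_concave`,
`liIncr_not_eventually_monotone/_antitone`, `not_convex/_concave_on_thick` (contrast ORDER 1: monotone on a thick set ⟹ RH, tree `rh_of_li_monotoneOn_thick`),
`not_xiao_conj_3_4_tail (n₀) : ¬ ∀ n ≥ n₀, 2λ_{n−1} − λ_{n−2} < λ_n` (no tail of Xiao 2020 Conj. 3.4 survives), `not_xiao_concave_tail`, `hasGapsLe_liSecondDiff_neg/_pos`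
(RH-FREE KERNEL THEOREMS, label L1).

HONEST LABEL: «SPLITTING SEARCH over kernel-typed RH-EQUIVALENCES; a splitting A ∧ B ⟹ RH is CONDITIONAL bookkeeping unless A and B are
both proved; nothing here bears on the truth of RH.»
-/

set_option linter.dupNamespace false

noncomputable section

namespace Summit.RiemannHypothesis.RiemannHypothesis.Theorems.Splittings.LiCurvatureSignChanges

open Complex Filter Topology Finset
open scoped Real ComplexConjugate
open Literature.NumberTheory.LFunctions
open Summit.RiemannHypothesis.RiemannHypothesis.Theorems.Splittings
open Summit.RiemannHypothesis.RiemannHypothesis.Theorems.Splittings.LiIndexSets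
open Summit.RiemannHypothesis.RiemannHypothesis.Theorems.Splittings.LiExtremalLayer
open Summit.RiemannHypothesis.RiemannHypothesis.Theorems.Splittings.LiSecondOrderCriterion
open Summit.RiemannHypothesis.RiemannHypothesis.Theorems.Splittings.LiWindowComplex

/-! ## §3 Under ¬RH: both signs, with ANY margin, in late windows of bounded length — a discrete convexity lemma on
top of the tree's two-signed exponential oscillation `li_two_signs_of_not_rh` -/

section NotRHBranch

/-- **Discrete convexity lemma.** The sign pattern `f p < 0 < f q`, `f s < 0` (`p < q < s`) is incompatible
with `Δ²f ≥ 0` on `[p, s−2]` (an ascent before `q`, a descent after `q`, but convexity makes the increments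
non-decreasing). -/
theorem no_convex_dip {f : ℕ → ℝ} {p q s : ℕ} (hpq : p < q) (hqs : q < s)
    (hp : f p < 0) (hq : 0 < f q) (hs : f s < 0)
    (hconv : ∀ n, p ≤ n → n + 2 ≤ s → 0 ≤ f (n + 2) - 2 * f (n + 1) + f n) : False := by
  have h1 : ∃ a, p ≤ a ∧ a < q ∧ f a < f (a + 1) := by
    by_contra h
    push Not at h
    obtain ⟨k, hk⟩ := Nat.exists_eq_add_of_lt hpq
    have hch := le_of_forall_incr (f := fun n ↦ -f n) p (k + 1) fun n hn1 hn2 ↦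
      neg_le_neg (h n hn1 (by omega))
    simp only [neg_le_neg_iff] at hch
    rw [show p + (k + 1) = q by omega] at hch
    linarith
  have h2 : ∃ b, q ≤ b ∧ b < s ∧ f (b + 1) < f b := by
    by_contra h
    push Not at h
    obtain ⟨k, hk⟩ := Nat.exists_eq_add_of_lt hqs
    have hch := le_of_forall_incr (f := f) q (k + 1) fun n hn1 hn2 ↦ h n hn1 (by omega)
    rw [show q + (k + 1) = s by omega] at hch
    linarith
  obtain ⟨a, hpa, haq, ha⟩ := h1
  obtain ⟨b, hqb, hbs, hb⟩ := h2
  obtain ⟨k, hk⟩ := Nat.exists_eq_add_of_le (show a ≤ b by omega)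
  have hmono := le_of_forall_incr (f := fun n ↦ f (n + 1) - f n) a k fun n hn1 hn2 ↦ by
    have := hconv n (by omega) (by omega)
    show f (n + 1) - f n ≤ f (n + 1 + 1) - f (n + 1)
    rw [show n + 1 + 1 = n + 2 from rfl]
    linarith
  rw [← hk] at hmono
  linarith

/-- The mirror statement: the pattern `f p > 0 > f q`, `f s > 0` is incompatible with `Δ²f ≤ 0` on `[p, s−2]`. -/
theorem no_concave_bump {f : ℕ → ℝ} {p q s : ℕ} (hpq : p < q) (hqs : q < s)
    (hp : 0 < f p) (hq : f q < 0) (hs : 0 < f s)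
    (hconc : ∀ n, p ≤ n → n + 2 ≤ s → f (n + 2) - 2 * f (n + 1) + f n ≤ 0) : False :=
  no_convex_dip (f := fun n ↦ -f n) hpq hqs (by linarith) (by linarith) (by linarith) fun n h1 h2 ↦ by
    have := hconc n h1 h2
    linarith

/-- Polynomial versus exponential: `η n²/2 < c·r₀^{-n}` for all large `n` (`0 < r₀ < 1`, `c > 0`). -/
theorem eventually_sq_lt_pow {r₀ c η : ℝ} (hr₀0 : 0 < r₀) (hr₀1 : r₀ < 1) (hc : 0 < c) (hη : 0 ≤ η) :
    ∃ n₂ : ℕ, ∀ n : ℕ, n₂ ≤ n → η / 2 * (n : ℝ) ^ 2 < c * r₀⁻¹ ^ n := by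
  have ht : Tendsto (fun n : ℕ ↦ (n : ℝ) ^ 2 * r₀ ^ n) atTop (𝓝 0) :=
    tendsto_pow_const_mul_const_pow_of_abs_lt_one 2 (by rw [abs_of_pos hr₀0]; exact hr₀1)
  obtain ⟨n₂, hn₂⟩ := Metric.tendsto_atTop.1 ht (c / (η / 2 + 1)) (by positivity)
  refine ⟨n₂, fun n hn ↦ ?_⟩
  have h := hn₂ n hn
  rw [Real.dist_0_eq_abs, abs_of_nonneg (by positivity), lt_div_iff₀ (by positivity)] at h
  have hpow : r₀ ^ n * r₀⁻¹ ^ n = 1 := by rw [← mul_pow, mul_inv_cancel₀ hr₀0.ne', one_pow]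
  have hpos : 0 < r₀⁻¹ ^ n := pow_pos (inv_pos.2 hr₀0) n
  have hX : 0 ≤ (n : ℝ) ^ 2 * r₀ ^ n := by positivity
  calc η / 2 * (n : ℝ) ^ 2 = η / 2 * (n : ℝ) ^ 2 * (r₀ ^ n * r₀⁻¹ ^ n) := by rw [hpow, mul_one]
    _ = (η / 2 * ((n : ℝ) ^ 2 * r₀ ^ n)) * r₀⁻¹ ^ n := by ring
    _ ≤ ((η / 2 + 1) * ((n : ℝ) ^ 2 * r₀ ^ n)) * r₀⁻¹ ^ n := by
        refine mul_le_mul_of_nonneg_right ?_ hpos.le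
        exact mul_le_mul_of_nonneg_right (by linarith) hX
    _ < c * r₀⁻¹ ^ n := by
        refine mul_lt_mul_of_pos_right ?_ hpos
        rw [mul_comm] at h
        exact h

/-- **¬RH branch.** If RH fails then for every margin `η ≥ 0` there are `L`, `n₁` such that every window
`[a, a+L)`, `a ≥ n₁`, contains an `n` with `d_n < −η` and an `n'` with `d_{n'} > η`. -/
theorem liSecondDiff_two_signs_of_not_rh (hRH : ¬ RiemannHypothesis) {η : ℝ} (hη : 0 ≤ η) :
    ∃ L n₁ : ℕ, ∀ a : ℕ, n₁ ≤ a →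
      (∃ n ∈ Ico a (a + L), keiperLiCoeff (n + 2) - 2 * keiperLiCoeff (n + 1) + keiperLiCoeff n < -η) ∧
      (∃ n ∈ Ico a (a + L), η < keiperLiCoeff (n + 2) - 2 * keiperLiCoeff (n + 1) + keiperLiCoeff n) := by
  obtain ⟨r₀, hr₀0, hr₀1, -, -, c, hc, -, L, n₁, -, hwin⟩ := li_two_signs_of_not_rh hRH
  obtain ⟨n₂, hn₂⟩ := eventually_sq_lt_pow hr₀0 hr₀1 hc hη
  have hpos : ∀ n : ℕ, 0 < c * r₀⁻¹ ^ n := fun n ↦ mul_pos hc (pow_pos (inv_pos.2 hr₀0) n)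
  have hcurv : ∀ n : ℕ, η / 2 * ((n : ℝ) + 2) ^ 2 - 2 * (η / 2 * ((n : ℝ) + 1) ^ 2) + η / 2 * (n : ℝ) ^ 2 = η := by
    intro n; ring
  refine ⟨3 * L, max n₁ n₂, fun a ha ↦ ?_⟩
  have ha1 : n₁ ≤ a := le_of_max_le_left ha
  have ha2 : n₂ ≤ a := le_of_max_le_right ha
  constructor
  · obtain ⟨p, hp, hlp⟩ := (hwin a ha1).2
    obtain ⟨q, hq, hlq⟩ := (hwin (a + L) (by omega)).1
    obtain ⟨s, hs, hls⟩ := (hwin (a + 2 * L) (by omega)).2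
    rw [Finset.mem_Ico] at hp hq hs
    by_contra hno
    push Not at hno
    refine no_convex_dip (f := fun n ↦ keiperLiCoeff n + η / 2 * (n : ℝ) ^ 2) (p := p) (q := q) (s := s)
      (by omega) (by omega) ?_ ?_ ?_ ?_
    · show keiperLiCoeff p + η / 2 * (p : ℝ) ^ 2 < 0
      have := hn₂ p (by omega)
      linarith
    · show 0 < keiperLiCoeff q + η / 2 * (q : ℝ) ^ 2
      have : 0 ≤ η / 2 * (q : ℝ) ^ 2 := by positivity
      linarith [hpos q]
    · show keiperLiCoeff s + η / 2 * (s : ℝ) ^ 2 < 0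
      have := hn₂ s (by omega)
      linarith
    · intro n hn1 hn2
      have hd := hno n (Finset.mem_Ico.2 ⟨by omega, by omega⟩)
      show 0 ≤ (keiperLiCoeff (n + 2) + η / 2 * ((n + 2 : ℕ) : ℝ) ^ 2)
        - 2 * (keiperLiCoeff (n + 1) + η / 2 * ((n + 1 : ℕ) : ℝ) ^ 2) + (keiperLiCoeff n + η / 2 * (n : ℝ) ^ 2)
      push_cast
      linarith [hcurv n]
  · obtain ⟨p, hp, hlp⟩ := (hwin a ha1).1
    obtain ⟨q, hq, hlq⟩ := (hwin (a + L) (by omega)).2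
    obtain ⟨s, hs, hls⟩ := (hwin (a + 2 * L) (by omega)).1
    rw [Finset.mem_Ico] at hp hq hs
    by_contra hno
    push Not at hno
    refine no_concave_bump (f := fun n ↦ keiperLiCoeff n - η / 2 * (n : ℝ) ^ 2) (p := p) (q := q) (s := s)
      (by omega) (by omega) ?_ ?_ ?_ ?_
    · show 0 < keiperLiCoeff p - η / 2 * (p : ℝ) ^ 2
      have := hn₂ p (by omega)
      linarith
    · show keiperLiCoeff q - η / 2 * (q : ℝ) ^ 2 < 0
      have : 0 ≤ η / 2 * (q : ℝ) ^ 2 := by positivity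
      linarith [hpos q]
    · show 0 < keiperLiCoeff s - η / 2 * (s : ℝ) ^ 2
      have := hn₂ s (by omega)
      linarith
    · intro n hn1 hn2
      have hd := hno n (Finset.mem_Ico.2 ⟨by omega, by omega⟩)
      show (keiperLiCoeff (n + 2) - η / 2 * ((n + 2 : ℕ) : ℝ) ^ 2)
        - 2 * (keiperLiCoeff (n + 1) - η / 2 * ((n + 1 : ℕ) : ℝ) ^ 2) + (keiperLiCoeff n - η / 2 * (n : ℝ) ^ 2) ≤ 0
      push_cast
      linarith [hcurv n]

end NotRHBranch

/-! ## §4 Unconditional corollaries (`Classical.em RiemannHypothesis`) -/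

section Unconditional

/-- **Both signs of the curvature on syndetic sets, unconditionally.** There are `η > 0` and `L` such that
EVERY window `[N, N+L)` contains an `n` with `d_n ≤ −η` and an `n'` with `d_{n'} ≥ η`. -/
theorem liSecondDiff_signs_syndetic :
    ∃ η : ℝ, 0 < η ∧ ∃ L : ℕ, ∀ N : ℕ,
      (∃ n ∈ Ico N (N + L), keiperLiCoeff (n + 2) - 2 * keiperLiCoeff (n + 1) + keiperLiCoeff n ≤ -η) ∧
      (∃ n ∈ Ico N (N + L), η ≤ keiperLiCoeff (n + 2) - 2 * keiperLiCoeff (n + 1) + keiperLiCoeff n) := by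
  by_cases hRH : RiemannHypothesis
  · obtain ⟨η, hη, L, hL⟩ := liSecondDiff_two_signs_of_rh hRH
    refine ⟨η, hη, L + 1, fun N ↦ ⟨?_, ?_⟩⟩
    · obtain ⟨n, hn, h⟩ := (hL (N + 1) (by omega)).2
      rw [Finset.mem_Ico] at hn
      exact ⟨n, Finset.mem_Ico.2 ⟨by omega, by omega⟩, h⟩
    · obtain ⟨n, hn, h⟩ := (hL (N + 1) (by omega)).1
      rw [Finset.mem_Ico] at hn
      exact ⟨n, Finset.mem_Ico.2 ⟨by omega, by omega⟩, h⟩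
  · obtain ⟨L, n₁, hL⟩ := liSecondDiff_two_signs_of_not_rh hRH zero_le_one
    refine ⟨1, one_pos, L + n₁, fun N ↦ ⟨?_, ?_⟩⟩
    · obtain ⟨n, hn, h⟩ := (hL (N + n₁) (by omega)).1
      rw [Finset.mem_Ico] at hn
      exact ⟨n, Finset.mem_Ico.2 ⟨by omega, by omega⟩, h.le⟩
    · obtain ⟨n, hn, h⟩ := (hL (N + n₁) (by omega)).2
      rw [Finset.mem_Ico] at hn
      exact ⟨n, Finset.mem_Ico.2 ⟨by omega, by omega⟩, h.le⟩

/-- `λ_n` is NOT eventually convex. -/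
theorem not_eventually_convex (n₀ : ℕ) :
    ∃ n : ℕ, n₀ ≤ n ∧ keiperLiCoeff (n + 2) - 2 * keiperLiCoeff (n + 1) + keiperLiCoeff n < 0 := by
  obtain ⟨η, hη, L, hL⟩ := liSecondDiff_signs_syndetic
  obtain ⟨n, hn, h⟩ := (hL n₀).1
  exact ⟨n, (Finset.mem_Ico.1 hn).1, by linarith⟩

/-- `λ_n` is NOT eventually concave. -/
theorem not_eventually_concave (n₀ : ℕ) :
    ∃ n : ℕ, n₀ ≤ n ∧ 0 < keiperLiCoeff (n + 2) - 2 * keiperLiCoeff (n + 1) + keiperLiCoeff n := by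
  obtain ⟨η, hη, L, hL⟩ := liSecondDiff_signs_syndetic
  obtain ⟨n, hn, h⟩ := (hL n₀).2
  exact ⟨n, (Finset.mem_Ico.1 hn).1, by linarith⟩

/-- The increments `λ_{n+1} − λ_n` are NOT eventually non-decreasing … -/
theorem liIncr_not_eventually_monotone (n₀ : ℕ) :
    ∃ n : ℕ, n₀ ≤ n ∧ keiperLiCoeff (n + 2) - keiperLiCoeff (n + 1) < keiperLiCoeff (n + 1) - keiperLiCoeff n := by
  obtain ⟨n, hn, h⟩ := not_eventually_convex n₀
  exact ⟨n, hn, by linarith⟩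

/-- … nor eventually non-increasing. -/
theorem liIncr_not_eventually_antitone (n₀ : ℕ) :
    ∃ n : ℕ, n₀ ≤ n ∧ keiperLiCoeff (n + 1) - keiperLiCoeff n < keiperLiCoeff (n + 2) - keiperLiCoeff (n + 1) := by
  obtain ⟨n, hn, h⟩ := not_eventually_concave n₀
  exact ⟨n, hn, by linarith⟩

/-- **Convexity on a thick index set is impossible** (contrast with ORDER ONE: monotonicity on a thick set ⟹ RH,
tree `rh_of_li_monotoneOn_thick`). -/
theorem not_convex_on_thick {S : Set ℕ} (hS : IsThick S) :
    ¬ ∀ n ∈ S, 0 ≤ keiperLiCoeff (n + 2) - 2 * keiperLiCoeff (n + 1) + keiperLiCoeff n := by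
  intro h
  obtain ⟨η, hη, L, hL⟩ := liSecondDiff_signs_syndetic
  obtain ⟨a, ha⟩ := hS L
  obtain ⟨n, hn, hneg⟩ := (hL a).1
  rw [Finset.mem_Ico] at hn
  obtain ⟨t, rfl⟩ := Nat.exists_eq_add_of_le hn.1
  have := h (a + t) (ha t (by omega))
  linarith

/-- Concavity on a thick index set is impossible. -/
theorem not_concave_on_thick {S : Set ℕ} (hS : IsThick S) :
    ¬ ∀ n ∈ S, keiperLiCoeff (n + 2) - 2 * keiperLiCoeff (n + 1) + keiperLiCoeff n ≤ 0 := by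
  intro h
  obtain ⟨η, hη, L, hL⟩ := liSecondDiff_signs_syndetic
  obtain ⟨a, ha⟩ := hS L
  obtain ⟨n, hn, hpos⟩ := (hL a).2
  rw [Finset.mem_Ico] at hn
  obtain ⟨t, rfl⟩ := Nat.exists_eq_add_of_le hn.1
  have := h (a + t) (ha t (by omega))
  linarith

/-- **No tail of Xiao's Conjecture 3.4 survives**: for every `n₀` the printed inequality
`λ_n > 2λ_{n−1} − λ_{n−2}` fails at some `n ≥ n₀` (the tree's `Xiao2020.not_xiao_conj_3_4` is the single
certified failure `n = 119`; this is the qualitative law behind it, from analysis alone). -/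
theorem not_xiao_conj_3_4_tail (n₀ : ℕ) :
    ¬ ∀ n : ℕ, n₀ ≤ n → 2 * keiperLiCoeff (n - 1) - keiperLiCoeff (n - 2) < keiperLiCoeff n := by
  intro h
  obtain ⟨m, hm, hneg⟩ := not_eventually_convex n₀
  have := h (m + 2) (by omega)
  rw [show m + 2 - 1 = m + 1 by omega, show m + 2 - 2 = m by omega] at this
  linarith

/-- … and the mirror (concavity) inequality has no tail either. -/
theorem not_xiao_concave_tail (n₀ : ℕ) :
    ¬ ∀ n : ℕ, n₀ ≤ n → keiperLiCoeff n < 2 * keiperLiCoeff (n - 1) - keiperLiCoeff (n - 2) := by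
  intro h
  obtain ⟨m, hm, hpos⟩ := not_eventually_concave n₀
  have := h (m + 2) (by omega)
  rw [show m + 2 - 1 = m + 1 by omega, show m + 2 - 2 = m by omega] at this
  linarith

/-- Tree vocabulary (`HasGapsLe`): the convexity-failure set has bounded gaps … -/
theorem hasGapsLe_liSecondDiff_neg :
    ∃ g : ℕ, HasGapsLe {n | keiperLiCoeff (n + 2) - 2 * keiperLiCoeff (n + 1) + keiperLiCoeff n < 0} g := by
  obtain ⟨η, hη, L, hL⟩ := liSecondDiff_signs_syndetic
  refine ⟨L, fun m ↦ ?_⟩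
  obtain ⟨n, hn, hneg⟩ := (hL m).1
  rw [Finset.mem_Ico] at hn
  exact ⟨n, by show _ < (0 : ℝ); linarith, hn.1, by omega⟩

/-- … and so has the concavity-failure set. -/
theorem hasGapsLe_liSecondDiff_pos :
    ∃ g : ℕ, HasGapsLe {n | 0 < keiperLiCoeff (n + 2) - 2 * keiperLiCoeff (n + 1) + keiperLiCoeff n} g := by
  obtain ⟨η, hη, L, hL⟩ := liSecondDiff_signs_syndetic
  refine ⟨L, fun m ↦ ?_⟩
  obtain ⟨n, hn, hpos⟩ := (hL m).2
  rw [Finset.mem_Ico] at hn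
  exact ⟨n, by show (0 : ℝ) < _; linarith, hn.1, by omega⟩

end Unconditional

end Summit.RiemannHypothesis.RiemannHypothesis.Theorems.Splittings.LiCurvatureSignChanges

end
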